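import Summits.BirchSwinnertonDyer.BirchSwinnertonDyer.Theorems.TwoAdicConverseLambdaHalfDefs
import Literature.NumberTheory.EllipticCurves.GaloisAction
import Literature.NumberTheory.EllipticCurves.QuadraticTwist
import Literature.NumberTheory.EllipticCurves.KatoDivisibilityAllPrimes
import HarnessLib

/-!
# Crux `OrdLambdaHalfAtTwo` (item stmt-BirchSwinnertonDyer-19556) — crux-ideate GEN 9 / ideator 1 sketch for the idea
# `xi-dominant-klingen-two` (ξ-DOMINANT Klingen–Eisenstein congruence on `GU(3,1)` at `p = 2`, Wan 2020 Thm 1.1 (2),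
# + two-variable zeta-element conversion Greenberg → ordinary ⊗ ℚ, BSTW 2024 Prop 1.19, + descent to the cyclotomic line)

NOTHING is asserted and BSD is not proved.  The file types, over existing declarations only,

* §0 the by-nature death of every `f`-DOMINANT Eisenstein-congruence placement at `2` (Mazur–Wiles / SU14 `U(2,2)` / CGLS
  all need two DISTINCT residual characters on the diagonal of `ρ̄_f|D_p`; with `𝔽₂`-coefficients there is exactly one
  character): `(ZMod 2)ˣ` is a singleton — kernel-checked;
* §1 the first honest rung R0 (algebra on `Λ = ℤ₂⟦T⟧`, PROVED): `λ` is blind to powers of `2` and monotone under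
  divisibility, so a divisibility «`L₀ ∣ 2ⁿ·g`» on the cyclotomic line is already the inequality `λ(L₀) ≤ λ(g)` — the
  exact strength in which Wan's case (2) («fractional ideals of `𝒪_L⟦Γ_K⟧ ⊗ L`») and Kato 17.4 (1)(2) are stated;
* §2 the numeric door: the JOINT inequality for the pair `(E, E^K)` on the cyclotomic line (what W2 + BF2 + descent
  deliver) and Kato ⊗ ℚ for the TWIST `E^K` alone give the leaf `LambdaHalfAtTwo W` for `E` (Kato for `E` itself is not
  even used);
* §3 the typed statements of the line: `JointLambdaHalfAtTwo W W'` (output of the two bets on the cyclotomic line),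
  `KatoLamAtTwo W'` (Kato's direction for the twist, a consequence of the tree fact `kato_divisibility_allPrimes W' 2`),
  the typed door `lambdaHalfAtTwo_of_joint`, and the printed habitat `OrdLambdaHalfAtTwoSurj` (= the habitat of the
  registered stub `Birth.stub_surj`: surjective mod-2 image).
-/

set_option linter.dupNamespace false
set_option autoImplicit false

noncomputable section

open scoped MatrixGroups ModularForm
open CongruenceSubgroup WeierstrassCurve Literature.NumberTheory.EllipticCurves
  Literature.NumberTheory.EllipticCurves.ModularForms Literature.NumberTheory.EllipticCurves.Rank1Residual
  Summit.BirchSwinnertonDyer.Rank1Residual.X1.MuLambda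
  Summit.BirchSwinnertonDyer.BirchSwinnertonDyer.Theorems.TwoAdicTwistConverse

namespace Summit.BirchSwinnertonDyer.BirchSwinnertonDyer.Cruxes.OrdLambdaHalfAtTwo.XiDominantKlingenTwo

/-! ## §0 Why every `f`-dominant placement is dead at `2`: there is ONE character with values in `𝔽₂ˣ` -/

/-- `𝔽₂ˣ = {1}`: any two `(ZMod 2)ˣ`-valued characters of any group coincide.  Hence the hypothesis (dist) of
Skinner–Urban 2014 («the two characters on the diagonal of `ρ̄_f|_{D_p}` are distinct mod `𝔪`») is unsatisfiable at
`p = 2` for the mod-`2` representation of ANY elliptic curve (both Jordan–Hölder characters of `ρ̄_{E,2}|_{D_2}` are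
`𝔽₂`-valued).  The ξ-dominant placement (Wan 2020, `U(3,1)`) has no such hypothesis. [folklore] -/
theorem modTwo_character_eq {G : Type*} [Group G] (χ₁ χ₂ : G →* (ZMod 2)ˣ) : χ₁ = χ₂ := by
  have hsub : ∀ u v : (ZMod 2)ˣ, u = v := by decide
  ext g
  rw [hsub (χ₁ g) (χ₂ g)]

/-- §0b (falsifier (b) of the card, kernel form). Two characters of a group with two elements
`{1, g}` (think `U^{(t-1)}/U^{(t)} ⊂ ℤ₂ˣ/U^{(t)}`, `t ≥ 2`) with values in the units of a domain that are
both non-trivial are EQUAL — so their ratio is trivial on `g`. Read for characters of `ℚ₂ˣ`: two characters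
of conductor exactly `2^t` have a ratio of conductor `≤ 2^{t-1}`; hence Wan's «generic» p-adic data
(arXiv:1408.4044, §5.8: `ξ₁, ξ₂, χ_p, χ_p⁻¹ξ₁, χ_p⁻¹ξ₂` ALL of conductor exactly `p^t`, the paper's only use
of `p ≥ 5`) form the EMPTY set at `p = 2` and must be re-typed with staggered conductors. At odd `p` the
quotient `U^{(t-1)}/U^{(t)} ≅ ℤ/p` has several non-trivial characters and no such collapse occurs. -/
theorem eq_of_ne_one_of_two_elements {H R : Type*} [Group H] [CommRing R] [NoZeroDivisors R]
    (g : H) (hg : g * g = 1) (hH : ∀ h : H, h = 1 ∨ h = g)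
    (χ₁ χ₂ : H →* Rˣ) (h₁ : χ₁ ≠ 1) (h₂ : χ₂ ≠ 1) : χ₁ = χ₂ := by
  have key : ∀ χ : H →* Rˣ, χ ≠ 1 → χ g = -1 := by
    intro χ hχ
    have h2 : (χ g : R) * (χ g : R) = 1 := by
      rw [← Units.val_mul, ← map_mul, hg, map_one, Units.val_one]
    rcases mul_self_eq_one_iff.1 h2 with h | h
    · exact absurd (MonoidHom.ext fun x => by
        rcases hH x with rfl | rfl
        · simp
        · exact Units.ext (by simpa using h)) hχ
    · exact Units.ext (by simpa using h)
  exact MonoidHom.ext fun x => by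
    rcases hH x with rfl | rfl
    · simp
    · rw [key χ₁ h₁, key χ₂ h₂]

/-- … and therefore the RATIO of two non-trivial characters of `{1, g}` is trivial (conductor drop). -/
theorem div_eq_one_of_ne_one_of_two_elements {H R : Type*} [Group H] [CommRing R] [NoZeroDivisors R]
    (g : H) (hg : g * g = 1) (hH : ∀ h : H, h = 1 ∨ h = g)
    (χ₁ χ₂ : H →* Rˣ) (h₁ : χ₁ ≠ 1) (h₂ : χ₂ ≠ 1) : ∀ h : H, χ₁ h * (χ₂ h)⁻¹ = 1 := by
  intro h
  rw [eq_of_ne_one_of_two_elements g hg hH χ₁ χ₂ h₁ h₂, mul_inv_cancel]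

/-! ## §1 Rung R0 (proved): on `Λ = ℤ_p⟦T⟧`, `λ` ignores `p`-powers and is monotone under divisibility -/

variable {p : ℕ} [Fact p.Prime]

/-- `pfree (p^n · g) = pfree g` for `g ≠ 0`. [folklore] -/
theorem pfree_C_pow_mul {g : IwasawaAlgebra p} (hg : g ≠ 0) (n : ℕ) :
    pfree (PowerSeries.C ((p : ℤ_[p]) ^ n) * g) = pfree g := by
  have h : PowerSeries.C ((p : ℤ_[p]) ^ n) * g =
      PowerSeries.C ((p : ℤ_[p]) ^ (n + mu g)) * pfree g := by
    conv_lhs => rw [eq_C_pow_mu_mul_pfree g]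
    rw [pow_add, map_mul]; ring
  exact (mu_eq_and_pfree_eq (red_pfree_ne_zero hg) h).2

/-- **`λ` is blind to the `μ`-part**: `λ(p^n · g) = λ(g)` (`g ≠ 0`). [folklore] -/
theorem lam_C_pow_mul {g : IwasawaAlgebra p} (hg : g ≠ 0) (n : ℕ) :
    lam (PowerSeries.C ((p : ℤ_[p]) ^ n) * g) = lam g := by
  unfold lam; rw [pfree_C_pow_mul hg n]

/-- **Rung R0.** A divisibility up to a power of `p` — `L · h = p^n · g` in `Λ`, i.e. `L ∣ g` in `Λ[1/p]` — already gives
`λ(L) ≤ λ(g)`.  This is the exact strength in which the line's inputs are printed (Wan 2020 Thm 1.1 (2): fractional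
ideals `⊗ L`; Kato 17.4 (1)(2): `Λ[1/p]`) and the exact strength the crux asks for. [folklore] -/
theorem lam_le_of_mul_eq_C_pow_mul {L h g : IwasawaAlgebra p} {n : ℕ} (hL : L ≠ 0) (hg : g ≠ 0)
    (heq : L * h = PowerSeries.C ((p : ℤ_[p]) ^ n) * g) : lam L ≤ lam g := by
  have hh : h ≠ 0 := by
    rintro rfl
    exact mul_ne_zero (C_pow_ne_zero n) hg (by rw [← heq, mul_zero])
  calc lam L ≤ lam (L * h) := lam_le_lam_mul hL hh
    _ = lam g := by rw [heq, lam_C_pow_mul hg n]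

/-! ## §2 The numeric door: joint inequality for `(E, E^K)` + Kato for the twist ⟹ the crux inequality for `E` -/

/-- `a, a'` = analytic `λ` of `E`, `E^K` on the cyclotomic line; `b, b'` = algebraic.  The 2-variable divisibility over
`K` descended to the cyclotomic line gives the SUM `a + a' ≤ b + b'`; Kato ⊗ ℚ for the twist gives `b' ≤ a'`; hence
`a ≤ b`.  (Kato for `E` itself is not used.) [folklore] -/
theorem le_of_sum_le_of_twist_le {a a' b b' : ℕ} (hsum : a + a' ≤ b + b') (hK' : b' ≤ a') : a ≤ b := by
  omega

/-! ## §3 Typed statements of the line -/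

/-- **Output of the two bets on the cyclotomic line** (W2 = Wan 2020 Thm 1.1 (2) at `p = 2` for `f_E` over an
imaginary quadratic `K` with `2` split, Greenberg divisibility in `𝒪⟦Γ_K⟧ ⊗ ℚ`; BF2 = BSTW 2024 Prop 1.19 ⊗ ℚ at `2`,
Greenberg ⇒ ordinary; then descent `Γ_K ↠ Γ^{cyc}` and Shapiro `X(E/Kℚ_∞) ~ X(E/ℚ_∞) ⊕ X(E^K/ℚ_∞)` ⊗ ℚ):
for the pair (`W`, `W'` — think `W' =` minimal model of the `K`-twist) and the SAME cyclotomic data, every nonzero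
integral rational multiple `L₀'` of `L₂(f')` is matched by one `L₀` of `L₂(f)` with
`λ(L₀) + λ(L₀') ≤ λ(X(W)) + λ(X(W'))`.  Not in print at `p = 2`; nothing asserted. -/
def JointLambdaHalfAtTwo (W W' : WeierstrassCurve ℚ) [W.IsElliptic] [W.IsGloballyMinimal] [W'.IsElliptic]
    [W'.IsGloballyMinimal] : Prop :=
  ∀ (κ : ZpExtension ℚ 2) (γ : Field.absoluteGaloisGroup ℚ),
    κ.IsCyclotomic → κ.IsTopGenerator γ → IsCyclotomicVariable 2 γ → IsOrdinaryAt W 2 → IsOrdinaryAt W' 2 →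
    ∀ [NeZero (W.conductorNorm ℤ)] (f : CuspForm (Gamma0 (W.conductorNorm ℤ)) 2), IsNewformOf W f →
    ∀ [NeZero (W'.conductorNorm ℤ)] (f' : CuspForm (Gamma0 (W'.conductorNorm ℤ)) 2), IsNewformOf W' f' →
    ∀ (D : W.SelmerDualData κ γ) (D' : W'.SelmerDualData κ γ) (c' : ℚ) (L₀' : IwasawaAlgebra 2), L₀' ≠ 0 →
      iwasawaToPowerSeries 2 L₀' = PowerSeries.C (c' : ℚ_[2]) * padicLFunction f' (unitRoot W' 2 : ℚ_[2]) →
      ∃ (c : ℚ) (L₀ : IwasawaAlgebra 2), L₀ ≠ 0 ∧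
        iwasawaToPowerSeries 2 L₀ = PowerSeries.C (c : ℚ_[2]) * padicLFunction f (unitRoot W 2 : ℚ_[2]) ∧
        lam L₀ + lam L₀' ≤ D.lambda + D'.lambda

/-- **Kato's direction for ONE curve, `λ`-component** (`λ(X(W')) ≤ λ(L₀')` for some nonzero integral rational multiple
`L₀'` of `L₂(f')`): a consequence of the tree's named fact `kato_divisibility_allPrimes W' 2` (Kato 17.4 (1)(2) at `2`,
`char X ∣ 2ⁿ L₂`) by rung R0 once `D'.charIdeal = (g)` is principal with `λ(g) = D'.lambda` (structure theory, in the
tree).  Stated, not re-derived here. [cite: Kato2004Asterisque, Thm. 17.4 (1)(2) (p. 273)] -/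
def KatoLamAtTwo (W' : WeierstrassCurve ℚ) [W'.IsElliptic] [W'.IsGloballyMinimal] : Prop :=
  ∀ (κ : ZpExtension ℚ 2) (γ : Field.absoluteGaloisGroup ℚ),
    κ.IsCyclotomic → κ.IsTopGenerator γ → IsCyclotomicVariable 2 γ → IsOrdinaryAt W' 2 →
    ∀ [NeZero (W'.conductorNorm ℤ)] (f' : CuspForm (Gamma0 (W'.conductorNorm ℤ)) 2), IsNewformOf W' f' →
    ∀ (D' : W'.SelmerDualData κ γ), ∃ (c' : ℚ) (L₀' : IwasawaAlgebra 2), L₀' ≠ 0 ∧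
      iwasawaToPowerSeries 2 L₀' = PowerSeries.C (c' : ℚ_[2]) * padicLFunction f' (unitRoot W' 2 : ℚ_[2]) ∧
      D'.lambda ≤ lam L₀'

/-- **Typed door.**  Joint inequality for `(W, W')` + Kato's `λ`-direction for `W'` ⟹ the crux leaf for `W`, given a
newform of `W'`, dual data for `W'` over every cyclotomic datum, and ordinarity of `W'` at `2` (for `W' = E^K` with `2`
split in `K`, `E^K ≃ E` over `ℚ₂`).  Pure logic + `le_of_sum_le_of_twist_le`; nothing asserted. -/
theorem lambdaHalfAtTwo_of_joint (W W' : WeierstrassCurve ℚ) [W.IsElliptic] [W.IsGloballyMinimal] [W'.IsElliptic]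
    [W'.IsGloballyMinimal] [NeZero (W'.conductorNorm ℤ)] (f' : CuspForm (Gamma0 (W'.conductorNorm ℤ)) 2)
    (hf' : IsNewformOf W' f') (hord' : IsOrdinaryAt W' 2)
    (D'of : ∀ (κ : ZpExtension ℚ 2) (γ : Field.absoluteGaloisGroup ℚ), κ.IsCyclotomic → κ.IsTopGenerator γ →
      W'.SelmerDualData κ γ)
    (hJ : JointLambdaHalfAtTwo W W') (hK' : KatoLamAtTwo W') : LambdaHalfAtTwo W := by
  intro κ γ hκ hγ hγ' hord _ f hf D
  obtain ⟨c', L₀', h0', hι', hKato⟩ := hK' κ γ hκ hγ hγ' hord' f' hf' (D'of κ γ hκ hγ)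
  obtain ⟨c, L₀, h0, hι, hsum⟩ := hJ κ γ hκ hγ hγ' hord hord' f hf f' hf' D (D'of κ γ hκ hγ) c' L₀' h0' hι'
  exact ⟨c, L₀, h0, hι, le_of_sum_le_of_twist_le hsum hKato⟩

/-- **Printed habitat of the line** = the crux on the surjective-mod-`2` stratum (Wan 2020 Thm 1.1 standing hypothesis
«`ρ̄_{f}|_{G_K}` absolutely irreducible»: at `2` this is image `GL₂(𝔽₂) ≅ S₃` and `K ≠ ℚ(√Δ_E)`, the second being a
condition on the CHOSEN `K`).  Identical to the habitat of the registered stub `Birth.stub_surj`. -/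
def OrdLambdaHalfAtTwoSurj : Prop :=
  ∀ (W : WeierstrassCurve ℚ) [W.IsElliptic] [W.IsGloballyMinimal], ¬ W.HasCM → GoodOrd W 2 →
    W.HasSurjectiveModNGaloisRep 2 → LambdaHalfAtTwo W

/-- The quadratic twist by `d` as a Weierstrass equation (tree: `WeierstrassCurve.quadraticTwist`); the line applies the
door with `W'` a global minimal model of `W.quadraticTwist d_K`. Display only. -/
example (W : WeierstrassCurve ℚ) (d : ℚ) : WeierstrassCurve ℚ := W.quadraticTwist d

/-- The tree's Kato fact at `2` that feeds `KatoLamAtTwo` (display of the exact constant). -/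
example (W' : WeierstrassCurve ℚ) [W'.IsElliptic] [W'.IsGloballyMinimal] {N : ℕ} [NeZero N]
    (f : CuspForm (Gamma0 N) 2) : Prop :=
  kato_divisibility_allPrimes W' 2 (f := f)

end Summit.BirchSwinnertonDyer.BirchSwinnertonDyer.Cruxes.OrdLambdaHalfAtTwo.XiDominantKlingenTwo

end
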